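import Summits.AtomisticToContinuum.FouriersLaw.Theses.CoercivePulse
import Summits.AtomisticToContinuum.FouriersLaw.Theorems.CageBudgetFeketeHeatVarianceCalculus
import Summits.AtomisticToContinuum.FouriersLaw.Theorems.CoercivePulseAbelRegularityCanonicalReduction
import Summits.AtomisticToContinuum.FouriersLaw.Theorems.CoercivePulseAbelRegularityAbelOfHeatVarianceSlope
import Summits.AtomisticToContinuum.FouriersLaw.Theorems.CoercivePulseAbelRegularityFeketeSlope
import Literature.MathematicalPhysics.KineticTheory.InfiniteChainGoodSetSymmetries
import HarnessLib

/-!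
# `AbelRegularity` from a cage budget: `CageBudgetFekete.QuasiSuperadditiveHeatVariance → CoercivePulse.AbelRegularity`
(crux `CoercivePulse.AbelRegularity`, item stmt-AtomisticToContinuum-15384; `--supports` helper file: it closes nothing,
it records the EDGE from the existing crux stmt-AtomisticToContinuum-15769 of route CageBudgetFekete; line lead `Sketch`,
continuation c1, 2026-08-17)

WHAT. If the equilibrium heat variance `V_T(τ) = 2∫₀^τ (τ-s) C_T(s) ds` of every guarded pair of the pinned anharmonic
chain is superadditive up to a bounded defect (`V(s) + V(t) ≤ V(s+t) + K`, the CAGE BUDGET crux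
`CageBudgetFekete.QuasiSuperadditiveHeatVariance`), then the Abel means `A(ν) = ∫₀^∞ e^{-νt} C_T(t) dt` converge in `ℝ`
or tend to `+∞` as `ν ↓ 0` (`CoercivePulse.AbelRegularity`). So the time-domain crux Q of the sibling route is a
SUFFICIENT condition for this crux — the Einstein–Helfand reading of line `Sketch`'s card
`integrable-anticorrelation-summable-defect` (which weakens Q's budget to a summable defect).

HOW (all ingredients landed). By `abelRegularity_of_witness` it suffices to treat the canonical pair at bath constant
`1` (transfer-operator state `μ`, Buttà–Marchioro dynamics `D`; its four extra guard clauses are theorems, as in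
`witness_of_abelRegularity`). `HeatVarianceCalculus.CanonicalRigidity.heatVarianceCalculus_proof` gives absolute
convergence, continuity of `C_T`, `V ≥ 0`, Laplace integrability of `V` and Helfand's identity
`A(ν) = (ν²/2)∫₀^∞ e^{-νt} V(t) dt`; Q gives the budget `K`; the continuous Fekete lemma
`slope_dichotomy_of_quasiSuperadditive` gives `V(t)/t → ℓ ∈ ℝ` or `→ +∞`; the Abelian steps `abel_tendsto_of_slope`
(Widder, index 2) and `abel_tendsto_atTop_of_slope` give `A → ℓ/2` or `A → +∞`.
-/

noncomputable section

namespace Summit.AtomisticToContinuum.FouriersLaw.Theorems.AbelRegularity.Sketch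

open MeasureTheory Filter Set
open scoped Topology BigOperators
open Literature.MathematicalPhysics.KineticTheory.HeatConduction

/-- **Cage budget ⇒ Abel regularity.** `CageBudgetFekete.QuasiSuperadditiveHeatVariance` (item
stmt-AtomisticToContinuum-15769: the heat variance of every guarded pair of `pinnedChain ω₂ lam β γ` is superadditive up
to a bounded defect) implies `CoercivePulse.AbelRegularity` (item stmt-AtomisticToContinuum-15384: the Abel means of the
summed current autocorrelation converge in `ℝ` or tend to `+∞` as `ν ↓ 0`): Fekete on the budgeted heat variance gives an
Einstein–Helfand slope `lim V(t)/t ∈ [0, +∞]`, and Helfand's Laplace identity with Widder's Abelian theorem (finite slope)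
or a direct comparison (infinite slope) transfers it to the Abel means; canonical pair by DLR uniqueness and dynamics
rigidity. [cite: Helfand1960, §II] [cite: Widder1941, Ch. V §1 Theorem 1] -/
theorem abelRegularity_of_quasiSuperadditiveHeatVariance :
    _root_.Summit.AtomisticToContinuum.FouriersLaw.Theses.CageBudgetFekete.QuasiSuperadditiveHeatVariance →
      _root_.Summit.AtomisticToContinuum.FouriersLaw.Theses.CoercivePulse.AbelRegularity := by
  intro hQ
  refine abelRegularity_of_witness fun ω₂ lam β hω hl hβ T hT => ?_
  -- the canonical pair at bath constant 1 and its guard clauses (as in `witness_of_abelRegularity`)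
  obtain ⟨μ, hG, hSI, hss⟩ :=
    OscillatorChain.exists_isChainGibbsMeasure_shiftInvariant_superstable_pinnedChain 1 hω hl.le hβ.le hT
  have hU2 : OscillatorChain.IsEvenPolyOfDegree (pinnedChain ω₂ lam β 1).U 2 :=
    OscillatorChain.pinnedChain_isEvenPolyOfDegree_U β 1 hω.le hl
  have hV2 : OscillatorChain.IsEvenPolyOfDegree (pinnedChain ω₂ lam β 1).V 2 :=
    OscillatorChain.pinnedChain_isEvenPolyOfDegree_V ω₂ lam 1 hβ
  have hU0 : ∀ r, 0 ≤ (pinnedChain ω₂ lam β 1).U r := hU2.choose_spec.2.2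
  have hV0 : ∀ r, 0 ≤ (pinnedChain ω₂ lam β 1).V r := hV2.choose_spec.2.2
  obtain ⟨D, hcar, -, -, -, -, -, hpres⟩ :=
    OscillatorChain.exists_bmDynamics (P := pinnedChain ω₂ lam β 1) (by norm_num) (by norm_num) hU2 hV2
  have hP : D.PreservesMeasure μ := hpres T μ hG hss
  have huniq : ∀ μ₁ μ₂ : Measure ChainConfig,
      (pinnedChain ω₂ lam β 1).IsChainGibbsMeasure T μ₁ → IsShiftInvariant μ₁ →
      (pinnedChain ω₂ lam β 1).HasSuperstabilityEstimate μ₁ →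
      (pinnedChain ω₂ lam β 1).IsChainGibbsMeasure T μ₂ → IsShiftInvariant μ₂ →
      (pinnedChain ω₂ lam β 1).HasSuperstabilityEstimate μ₂ → μ₁ = μ₂ :=
    fun μ₁ μ₂ h₁ hS₁ _ h₂ hS₂ _ =>
      OscillatorChain.eq_of_isChainGibbsMeasure_of_isShiftInvariant_pinnedChain 1 hω hl.le hβ.le hT h₁ hS₁ h₂ hS₂
  have hrev : μ.map (fun σ : ChainConfig => fun x : ℤ => ((σ x).1, -(σ x).2)) = μ := by
    have h' := OscillatorChain.map_momentumReversalZ_eq_of_regular_unique hG hSI hss huniq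
    rw [coe_momentumReversalZ] at h'
    exact h'
  have hcov : ∀ t : ℝ, ∀ᵐ σ ∂μ, D.flow t (shift σ) = shift (D.flow t σ) := by
    intro t
    have h2 := D.flow_comp_chainShift_ae_of_carrier_eq_bmGood hcar hU0 hV0 hP.1 t 1
    filter_upwards [h2] with σ hσ2
    rw [← chainShift_one]
    exact hσ2
  -- the heat-variance calculus of the canonical pair (landed) and the cage budget `K`
  obtain ⟨hAC, hCc, hVcl⟩ := HeatVarianceCalculus.CanonicalRigidity.heatVarianceCalculus_proof ω₂ lam β 1 hω hl hβ T
    hT μ hG hSI hrev D hP hcov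
  set V : ℝ → ℝ := fun τ : ℝ => 2 * ∫ s in Set.Ioc (0:ℝ) τ, (τ - s) * D.currentCorrelation μ s with hVdef
  obtain ⟨hVnonneg, hLap⟩ := hVcl V hVdef
  obtain ⟨K, -, hQ'⟩ := hQ ω₂ lam β 1 hω hl hβ T hT μ hG hSI hrev D hP hcov hAC hCc V hVdef
  have hint : ∀ s : ℝ, 0 < s → IntegrableOn (fun t : ℝ => Real.exp (-(s * t)) * V t) (Ioi 0) :=
    fun s hs => (hLap s hs).2.1
  have hA : ∀ ν : ℝ, 0 < ν → (fun ν : ℝ => ∫ t in Ioi (0:ℝ), Real.exp (-(ν * t)) * D.currentCorrelation μ t) ν =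
      ν ^ 2 / 2 * ∫ t in Ioi (0:ℝ), Real.exp (-(ν * t)) * V t := fun ν hν => (hLap ν hν).2.2
  refine ⟨μ, D, hG, hSI, hP, ?_⟩
  -- Fekete ⇒ Einstein–Helfand slope; Abelian steps ⇒ the dichotomy
  rcases slope_dichotomy_of_quasiSuperadditive hVnonneg hQ' with ⟨ℓ, hℓ⟩ | hinf
  · exact Or.inl ⟨ℓ / 2, abel_tendsto_of_slope hint hA hℓ⟩
  · exact Or.inr (abel_tendsto_atTop_of_slope (fun t ht => hVnonneg t ht.le) hint hA hinf)

end Summit.AtomisticToContinuum.FouriersLaw.Theorems.AbelRegularity.Sketch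

end
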